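import Summits.KontsevichZagierPeriods.KontsevichZagierPeriods.Theses.TorsionLogs
import Summits.KontsevichZagierPeriods.KontsevichZagierPeriods.Theorems.TorsionLogsTorsionSectorCompleteReductions
import Summits.KontsevichZagierPeriods.KontsevichZagierPeriods.Theses.HermiteRigidity
import Summits.KontsevichZagierPeriods.KontsevichZagierPeriods.Theorems.FurushoPentagonSectorToKernelOfLeaves

/-!
# KontsevichZagierPeriods / TorsionLogs — split glue of the crux `TorsionSectorComplete` (stmt-KontsevichZagierPeriods-14212)

Route `KontsevichZagierPeriods/TorsionLogs`, crux-strategist re-audit r1 (RESTATED deciding crux, BC2 redirect).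
With the co-binder `NeronTorsionSector` (stmt-14500) PROVED, the crux `TorsionSectorComplete` is equivalent to
the summit in the tree (`TorsionSectorComplete.iff_summit_of_sector`).  The typed decomposition filed here is
the hub's canonical FLT-shaped one, by the two EXISTING hub items (children dedup by normalised signature):

* `X₁ = CubeResolution` (stmt-KontsevichZagierPeriods-17978): every integral representation is congruent
  modulo `KZ.relations` to a `ℤ`-combination of tame cube classes `[[0,1]ⁿ, f]`, `f` real analytic near the
  closed cube — geometry INSIDE the rules, transcendence-free (a theorem in substance: see
  `CubeResolutionNow.lean` of the same filing, `cubeResolution_holds`, from the landed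
  `cubeNashNormalForm_proof` and `cubeResolution_of_cubeNashNormalForm`);
* `X₂ = AyoubEffectiveCubeKernel` (stmt-KontsevichZagierPeriods-18116): J. Ayoub, Ann. of Math. 181 (2015)
  Conj. 1.1 = J. Fresán, X-UPS 2024 Conj. 3.5 at `k = ℚ` — the kernel of `∫_{[0,1]^∞}` on
  `𝒪_{ℚ-alg}(𝔻̄^∞)` is the `ℚ`-span of the type-(a) Stokes elements (open; registered skeleton
  `localise-at-two-pi-i`: `stub_oanLocalizedKernel`, `stub_oanPiCancellation`).

Assembly: `X₁ → X₂ → TorsionSectorComplete` — a one-line seam over the LANDED ≈ 3 000-line bridge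
`FurushoPentagon.SectorToKernel.kontsevichZagierPeriods_of_cubeResolution_of_ayoubKernel` (Theorems/FurushoPentagonSectorToKernelOfLeaves.lean, p101326)
(resolution into the tame span, cube merge, Ayoub admissibility, real Stokes form, semialgebraic primitives,
padding + calibration ⇒ kernel form of Conjecture 1 ⇒ the summit) followed by
`TorsionLogs.TorsionSectorComplete.of_summit` (the summit gives the crux: `relations ≤ relations ⊔ closure T`).

-- adapted from Cruxes/ReductionRigidity/SplitR1GlueClose.lean (planner-cstrat-stmt-KontsevichZagierPeriods-3407-r1-0)
References: M. Kontsevich, D. Zagier, *Periods* (2001), §1.2, Conjecture 1; J. Ayoub, Ann. of Math. 181 (2015),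
Conj. 1.1; J. Ayoub, EMS Newsl. 91 (2014), Rem. 12–13; A. Huber, S. Müller-Stach, *Periods and Nori Motives* (2017), §13.1.
-/

namespace Summit.KontsevichZagierPeriods.TorsionLogs.TorsionSectorCompleteSplit

open Literature.NumberTheory.Transcendental

/-- **Split glue `TorsionSectorCompleteOfCubes`** (BC2 redirect of the restated crux `TorsionSectorComplete`,
stmt-KontsevichZagierPeriods-14212): `CubeResolution → AyoubEffectiveCubeKernel → TorsionSectorComplete`, the two
children written out verbatim (they are the hub items stmt-17978 / stmt-18116).
[cite: KontsevichZagier2001, §1.2  Conjecture 1] [cite: Ayoub2015, Conj. 1.1] [folklore] -/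
theorem TorsionSectorComplete_of_subs
    (h₁ : ∀ (N : ℕ) (u : Literature.NumberTheory.Transcendental.KZ.IntegralRep N), ∃ c ∈ AddSubgroup.closure {d : Literature.NumberTheory.Transcendental.KZ.FormalRep | ∃ (n : ℕ) (r : Literature.NumberTheory.Transcendental.KZ.IntegralRep n), r.domain = {x : Fin n → ℝ | ∀ i, 0 ≤ x i ∧ x i ≤ 1} ∧ AnalyticOnNhd ℝ r.integrand {x : Fin n → ℝ | ∀ i, 0 ≤ x i ∧ x i ≤ 1} ∧ d = Literature.NumberTheory.Transcendental.KZ.of r}, Literature.NumberTheory.Transcendental.KZ.of u - c ∈ Literature.NumberTheory.Transcendental.KZ.relations)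
    (h₂ : ∀ F ∈ Literature.NumberTheory.Transcendental.AyoubRel.Oan (Rat.castHom ℂ), Literature.NumberTheory.Transcendental.AyoubRel.intC F = 0 → F ∈ Literature.NumberTheory.Transcendental.AyoubRel.kSpan (Rat.castHom ℂ) {x : Literature.NumberTheory.Transcendental.AyoubRel.CSeries | ∃ G ∈ Literature.NumberTheory.Transcendental.AyoubRel.Oan (Rat.castHom ℂ), ∃ i : ℕ, x = Literature.NumberTheory.Transcendental.AyoubRel.relAC i G}) :
    Summit.KontsevichZagierPeriods.KontsevichZagierPeriods.Theses.TorsionLogs.TorsionSectorComplete :=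
  Summit.KontsevichZagierPeriods.TorsionLogs.TorsionSectorComplete.of_summit
    (Summit.KontsevichZagierPeriods.FurushoPentagon.SectorToKernel.kontsevichZagierPeriods_of_cubeResolution_of_ayoubKernel
      (fun N u => by
        -- item stmt-17978 IS the cubical resolution S1: definitional unfolding of `cubicalSpan` / `cubicalGens` / `unitCube`
        obtain ⟨c, hc, huc⟩ := h₁ N u
        exact ⟨c, hc, huc⟩)
      h₂)

/-- The same glue over the hub's route decls BY NAME (`HermiteRigidity.CubeResolution`, stmt-17978;
`HermiteRigidity.AyoubEffectiveCubeKernel`, stmt-18116). [folklore] -/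
theorem TorsionSectorComplete_of_items
    (h₁ : Summit.KontsevichZagierPeriods.KontsevichZagierPeriods.Theses.HermiteRigidity.CubeResolution)
    (h₂ : Summit.KontsevichZagierPeriods.KontsevichZagierPeriods.Theses.HermiteRigidity.AyoubEffectiveCubeKernel) :
    Summit.KontsevichZagierPeriods.KontsevichZagierPeriods.Theses.TorsionLogs.TorsionSectorComplete :=
  TorsionSectorComplete_of_subs h₁ h₂

#print axioms TorsionSectorComplete_of_subs
#print axioms TorsionSectorComplete_of_items

end Summit.KontsevichZagierPeriods.TorsionLogs.TorsionSectorCompleteSplit
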